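import Summits.QuantumAdvantage.QuantumAdvantage.Theorems.CharDialMultiBlockMoebius
import HarnessLib

/-!
# JBlockTop — top Möbius coefficients of functions of one block-linear form

(decomp-qadv-lens-6 g8, support file for `JBlockFrob.lean`.)  Tools for comparing the DIRECTIONS of two
representations `u ↦ h(Σ_j a_j wt_{A_j}(u))`:
* `SubLog.sub_mem_lowDeg_of_split` — if `g = g₀ + [u_i](g₁ − g₀)` with `g₀, g₁` free of `u_i` and `deg g ≤ d + 1`
  then `deg (g₁ − g₀) ≤ d` (Möbius coefficients + `moeb_insert`);
* `moeb_blockTop` / `moeb_blockNext` — the Möbius coefficient of `[h(Σ a_j wt_j)]` at `p − 1` coordinates of block `j`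
  is `(−1)^{p−1} Σ_{s<p} [h(a_j s)]`, and at `p − 2` coordinates of block `j` plus one of block `k` it is
  `(−1)^p Σ_{s<p−1} (s+1)([h(a_j s + a_k)] − [h(a_j s)])` (`C(p−1,s) ≡ (−1)^s`, `C(p−2,s) ≡ (−1)^s (s+1)`);
* (their values `resCount h` resp. `−(a_k/a_j)·resCount h`, and `direction_extract`, are in `JBlockFrob.lean`).
-/

namespace Summit.QuantumAdvantage.AdviceFreeQNC0

namespace SubLog

open Finset
open Literature.Computability.MetaComplexity Literature.Computability.MetaComplexity.Smolensky

variable {n : ℕ}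

section Ring

variable {R : Type*} [CommRing R]

/-- CharDial sub-characteristic helper `moeb_congr_on` (lens-6 g8 LAND package; see the module docstring). -/
theorem moeb_congr_on {g g' : (Fin n → Bool) → R} {S : Finset (Fin n)}
    (h : ∀ T ⊆ S, g (vert T) = g' (vert T)) : moeb g S = moeb g' S := by
  unfold moeb
  exact Finset.sum_congr rfl fun T hT => by rw [h T (mem_powerset.1 hT)]

/-- A function not depending on coordinate `i` has vanishing Möbius coefficient at every `S ∋ i`. -/
theorem moeb_eq_zero_of_indep {g : (Fin n → Bool) → R} {i : Fin n}
    (hg : ∀ u b, g (Function.update u i b) = g u) {S : Finset (Fin n)} (hi : i ∈ S) : moeb g S = 0 := by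
  classical
  rw [← insert_erase hi, moeb_insert (Finset.notMem_erase i S)]
  have : setT i g = g := funext fun u => hg u true
  rw [this, sub_self]

end Ring

section Field

variable {F : Type*} [Field F]

/-- Converse degree test: vanishing of all Möbius coefficients above `d` puts `g` in `lowDeg d`. -/
theorem mem_lowDeg_of_moeb_eq_zero {d : ℕ} {g : CubeFn F n}
    (h : ∀ S : Finset (Fin n), d < S.card → moeb g S = 0) : g ∈ lowDeg F n d := by
  classical
  rw [eq_sum_moeb_smul_mono g]
  refine Submodule.sum_mem _ fun S _ => ?_
  by_cases hS : d < S.card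
  · rw [h S hS, zero_smul]; exact Submodule.zero_mem _
  · exact Submodule.smul_mem _ _ (mono_mem_lowDeg (not_lt.1 hS))

/-- **Single-coordinate splitting.** If `g(u) = g₁(u)` for `u_i = 1` and `g(u) = g₀(u)` for `u_i = 0`, with `g₀, g₁`
independent of `u_i` and `deg g ≤ d + 1`, then `deg (g₁ − g₀) ≤ d`. -/
theorem sub_mem_lowDeg_of_split {d : ℕ} {g g₀ g₁ : CubeFn F n} {i : Fin n} (hg : g ∈ lowDeg F n (d + 1))
    (h₀ : ∀ u b, g₀ (Function.update u i b) = g₀ u) (h₁ : ∀ u b, g₁ (Function.update u i b) = g₁ u)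
    (hsplit : ∀ u, g u = if u i then g₁ u else g₀ u) : g₁ - g₀ ∈ lowDeg F n d := by
  classical
  refine mem_lowDeg_of_moeb_eq_zero fun S hS => ?_
  by_cases hi : i ∈ S
  · exact moeb_eq_zero_of_indep (fun u b => by simp only [Pi.sub_apply, h₀, h₁]) hi
  · have h0 : moeb g (insert i S) = 0 :=
      moeb_eq_zero_of_mem_lowDeg hg (by rw [card_insert_of_notMem hi]; omega)
    rw [moeb_insert hi] at h0
    have e1 : moeb (setT i g) S = moeb g₁ S := by
      refine moeb_congr_on fun T _ => ?_
      show g (Function.update (vert T) i true) = g₁ (vert T)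
      rw [hsplit]
      simp [h₁]
    have e0 : moeb g S = moeb g₀ S := by
      refine moeb_congr_on fun T hT => ?_
      rw [hsplit]
      have : vert T i = false := by
        simp only [vert, decide_eq_false_iff_not]
        exact fun h => hi (hT h)
      rw [this]
      simp
    rw [moeb_sub, ← e1, ← e0]
    exact h0

end Field

end SubLog

namespace SubChar

open Finset
open Literature.Computability.MetaComplexity Literature.Computability.MetaComplexity.Smolensky
open SubLog

variable {n m : ℕ}

/-! ### Block weights under substitutions -/

/-- CharDial sub-characteristic helper `bw_congr` (lens-6 g8 LAND package; see the module docstring). -/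
theorem bw_congr {A : Finset (Fin n)} {u v : Fin n → Bool} (h : ∀ i ∈ A, u i = v i) : bw A u = bw A v := by
  unfold bw
  rw [Finset.filter_congr fun i hi => by rw [h i hi]]

/-- CharDial sub-characteristic helper `bw_update_of_notMem` (lens-6 g8 LAND package; see the module docstring). -/
theorem bw_update_of_notMem {A : Finset (Fin n)} {i : Fin n} (hi : i ∉ A) (u : Fin n → Bool) (b : Bool) :
    bw A (Function.update u i b) = bw A u :=
  bw_congr fun k hk => by rw [Function.update_of_ne (ne_of_mem_of_not_mem hk hi)]

/-- CharDial sub-characteristic helper `subset_blockUnion` (lens-6 g8 LAND package; see the module docstring). -/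
theorem subset_blockUnion (A : Fin m → Finset (Fin n)) (j : Fin m) : A j ⊆ blockUnion A :=
  Finset.subset_biUnion_of_mem A (mem_univ j)

/-- CharDial sub-characteristic helper `bw_vert_insert` (lens-6 g8 LAND package; see the module docstring). -/
theorem bw_vert_insert (A T : Finset (Fin n)) {k0 : Fin n} (hk0T : k0 ∉ T) :
    bw A (vert (insert k0 T)) = (T ∩ A).card + (if k0 ∈ A then 1 else 0) := by
  classical
  rw [bw_vert]
  by_cases h : k0 ∈ A
  · have e : insert k0 T ∩ A = insert k0 (T ∩ A) := by
      ext i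
      simp only [mem_inter, mem_insert]
      constructor
      · rintro ⟨rfl | hi, hA⟩
        · exact Or.inl rfl
        · exact Or.inr ⟨hi, hA⟩
      · rintro (rfl | ⟨hi, hA⟩)
        · exact ⟨Or.inl rfl, h⟩
        · exact ⟨Or.inr hi, hA⟩
    rw [e, card_insert_of_notMem (fun hm => hk0T (mem_inter.1 hm).1), if_pos h]
  · have e : insert k0 T ∩ A = T ∩ A := by
      ext i
      simp only [mem_inter, mem_insert]
      constructor
      · rintro ⟨rfl | hi, hA⟩
        · exact absurd hA h
        · exact ⟨hi, hA⟩
      · rintro ⟨hi, hA⟩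
        exact ⟨Or.inr hi, hA⟩
    rw [e, if_neg h, add_zero]

/-! ### The block-linear form of a coefficient vector -/

variable {p : ℕ} [hp : Fact p.Prime]

/-- `Σ_j a_j · wt_{A_j}(u)` in `𝔽_p`. -/
def blin (A : Fin m → Finset (Fin n)) (a : Fin m → ZMod p) (u : Fin n → Bool) : ZMod p :=
  ∑ j, a j * (bw (A j) u : ZMod p)

/-- CharDial sub-characteristic helper `blin_congr` (lens-6 g8 LAND package; see the module docstring). -/
theorem blin_congr {A : Fin m → Finset (Fin n)} (a : Fin m → ZMod p) {u v : Fin n → Bool}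
    (h : ∀ j, bw (A j) u = bw (A j) v) : blin A a u = blin A a v := by
  unfold blin
  exact Finset.sum_congr rfl fun j _ => by rw [h j]

/-- CharDial sub-characteristic helper `blin_smul` (lens-6 g8 LAND package; see the module docstring). -/
theorem blin_smul {A : Fin m → Finset (Fin n)} (a : Fin m → ZMod p) (c : ZMod p) (u : Fin n → Bool) :
    blin A (fun j => c * a j) u = c * blin A a u := by
  unfold blin
  rw [Finset.mul_sum]
  exact Finset.sum_congr rfl fun j _ => by ring

/-- CharDial sub-characteristic helper `blin_zero_coeff` (lens-6 g8 LAND package; see the module docstring). -/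
theorem blin_zero_coeff {A : Fin m → Finset (Fin n)} {a : Fin m → ZMod p} (ha : ∀ j, a j = 0) (u : Fin n → Bool) :
    blin A a u = 0 := by
  unfold blin
  exact Finset.sum_eq_zero fun j _ => by rw [ha j, zero_mul]

/-- CharDial sub-characteristic helper `blin_vert_subset` (lens-6 g8 LAND package; see the module docstring). -/
theorem blin_vert_subset {A : Fin m → Finset (Fin n)} (hdis : ∀ j k, j ≠ k → Disjoint (A j) (A k))
    {j : Fin m} {T : Finset (Fin n)} (hT : T ⊆ A j) (a : Fin m → ZMod p) :
    blin A a (vert T) = a j * (T.card : ZMod p) := by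
  classical
  unfold blin
  simp_rw [bw_vert]
  rw [Finset.sum_eq_single j]
  · rw [inter_eq_left.2 hT]
  · intro k _ hkj
    have : T ∩ A k = ∅ := disjoint_iff_inter_eq_empty.1 ((hdis j k (Ne.symm hkj)).mono_left hT)
    rw [this, card_empty, Nat.cast_zero, mul_zero]
  · intro h; exact absurd (mem_univ j) h

/-- CharDial sub-characteristic helper `blin_vert_insert` (lens-6 g8 LAND package; see the module docstring). -/
theorem blin_vert_insert {A : Fin m → Finset (Fin n)} (hdis : ∀ j k, j ≠ k → Disjoint (A j) (A k))
    {j k : Fin m} {T : Finset (Fin n)} (hT : T ⊆ A j) {k0 : Fin n} (hk0 : k0 ∈ A k)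
    (hk0T : k0 ∉ T) (a : Fin m → ZMod p) :
    blin A a (vert (insert k0 T)) = a j * (T.card : ZMod p) + a k := by
  classical
  have h1 : blin A a (vert (insert k0 T)) =
      ∑ l, (a l * ((T ∩ A l).card : ZMod p) + a l * (if k0 ∈ A l then 1 else 0)) := by
    unfold blin
    refine Finset.sum_congr rfl fun l _ => ?_
    rw [bw_vert_insert (A l) T hk0T]
    push_cast
    split_ifs <;> ring
  rw [h1, Finset.sum_add_distrib]
  have h2 : ∑ l, a l * ((T ∩ A l).card : ZMod p) = a j * (T.card : ZMod p) := by
    have := blin_vert_subset hdis hT a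
    unfold blin at this
    simp_rw [bw_vert] at this
    exact this
  have h3 : ∑ l, a l * (if k0 ∈ A l then (1 : ZMod p) else 0) = a k := by
    rw [Finset.sum_eq_single k]
    · rw [if_pos hk0, mul_one]
    · intro l _ hlk
      rw [if_neg (fun h => (disjoint_left.1 (hdis k l (Ne.symm hlk)) hk0) h), mul_zero]
    · intro h; exact absurd (mem_univ k) h
  rw [h2, h3]

/-! ### Binomial coefficients mod p -/

/-- `C(p−2, s) ≡ (−1)^s (s+1) (mod p)` for `s ≤ p − 2`. -/
theorem choose_predpred_prime_cast (p : ℕ) [hp : Fact p.Prime] : ∀ s : ℕ, s ≤ p - 2 →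
    (((p - 2).choose s : ℕ) : ZMod p) = (-1) ^ s * ((s : ZMod p) + 1) := by
  intro s
  induction s with
  | zero => intro _; simp
  | succ s ih =>
    intro hs
    have h1 : (p - 2).choose s + (p - 2).choose (s + 1) = (p - 1).choose (s + 1) := by
      have h := Nat.choose_succ_succ' (p - 2) s
      rw [show p - 2 + 1 = p - 1 by omega] at h
      omega
    have h2 : (((p - 2).choose s : ℕ) : ZMod p) + (((p - 2).choose (s + 1) : ℕ) : ZMod p) = (-1) ^ (s + 1) := by
      rw [← Nat.cast_add, h1, choose_pred_prime_cast p (s + 1) (by omega)]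
    rw [eq_sub_of_add_eq' h2, ih (by omega), pow_succ]
    push_cast
    ring

/-! ### Top Möbius coefficients of `[h(Σ a_j wt_j)]` -/

/-- At `p − 1` coordinates of block `j`: `(−1)^{p−1} Σ_{s<p} [h(a_j s)]`. -/
theorem moeb_blockTop {A : Fin m → Finset (Fin n)} (hdis : ∀ j k, j ≠ k → Disjoint (A j) (A k))
    {j : Fin m} {S : Finset (Fin n)} (hS : S ⊆ A j) (hcard : S.card = p - 1)
    (hh : ZMod p → Bool) (a : Fin m → ZMod p) :
    moeb (fun u => if hh (blin A a u) then (1 : ZMod p) else 0) S =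
      (-1) ^ (p - 1) * ∑ s ∈ range p, (if hh (a j * (s : ZMod p)) then (1 : ZMod p) else 0) := by
  classical
  have hp1 : 1 < p := hp.out.one_lt
  unfold moeb
  have h1 : ∀ T ∈ S.powerset,
      (-1 : ZMod p) ^ (S.card - T.card) * (if hh (blin A a (vert T)) then (1 : ZMod p) else 0) =
        (fun t : ℕ => (-1 : ZMod p) ^ (p - 1 - t) * (if hh (a j * (t : ZMod p)) then (1 : ZMod p) else 0))
          T.card := by
    intro T hT
    simp only
    rw [blin_vert_subset hdis ((mem_powerset.1 hT).trans hS), hcard]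
  rw [Finset.sum_congr rfl h1, Finset.sum_powerset_apply_card
    (fun t : ℕ => (-1 : ZMod p) ^ (p - 1 - t) * (if hh (a j * (t : ZMod p)) then (1 : ZMod p) else 0)),
    hcard, Nat.sub_add_cancel hp1.le, Finset.mul_sum]
  refine Finset.sum_congr rfl fun s hs => ?_
  have hs' : s < p := mem_range.1 hs
  rw [nsmul_eq_mul, choose_pred_prime_cast p s hs', ← mul_assoc, ← pow_add,
    show s + (p - 1 - s) = p - 1 by omega]

/-- At `p − 2` coordinates of block `j` plus one coordinate of block `k ≠ j`:
`(−1)^p Σ_{s<p−1} (s+1)([h(a_j s + a_k)] − [h(a_j s)])`. -/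
theorem moeb_blockNext {A : Fin m → Finset (Fin n)} (hdis : ∀ j k, j ≠ k → Disjoint (A j) (A k))
    {j k : Fin m} (hjk : j ≠ k) {S : Finset (Fin n)} (hS : S ⊆ A j) (hcard : S.card = p - 2)
    {k0 : Fin n} (hk0 : k0 ∈ A k) (hh : ZMod p → Bool) (a : Fin m → ZMod p) :
    moeb (fun u => if hh (blin A a u) then (1 : ZMod p) else 0) (insert k0 S) =
      (-1) ^ p * ∑ s ∈ range (p - 1), ((s : ZMod p) + 1) *
        ((if hh (a j * (s : ZMod p) + a k) then (1 : ZMod p) else 0) -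
          (if hh (a j * (s : ZMod p)) then (1 : ZMod p) else 0)) := by
  classical
  have hp1 : 1 < p := hp.out.one_lt
  have hk0S : k0 ∉ S := fun h => (disjoint_left.1 (hdis j k hjk) (hS h)) hk0
  rw [moeb_insert hk0S]
  have e1 : moeb (setT k0 fun u => if hh (blin A a u) then (1 : ZMod p) else 0) S =
      ∑ s ∈ range (p - 2 + 1), ((p - 2).choose s) •
        ((-1 : ZMod p) ^ (p - 2 - s) * (if hh (a j * (s : ZMod p) + a k) then (1 : ZMod p) else 0)) := by
    unfold moeb
    have h1 : ∀ T ∈ S.powerset, (-1 : ZMod p) ^ (S.card - T.card) *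
        setT k0 (fun u => if hh (blin A a u) then (1 : ZMod p) else 0) (vert T) =
          (fun t : ℕ => (-1 : ZMod p) ^ (p - 2 - t) *
            (if hh (a j * (t : ZMod p) + a k) then (1 : ZMod p) else 0)) T.card := by
      intro T hT
      have hT' : T ⊆ A j := (mem_powerset.1 hT).trans hS
      have hk0T : k0 ∉ T := fun h => hk0S ((mem_powerset.1 hT) h)
      show (-1 : ZMod p) ^ (S.card - T.card) *
          (if hh (blin A a (Function.update (vert T) k0 true)) then (1 : ZMod p) else 0) = _
      rw [← vert_insert, blin_vert_insert hdis hT' hk0 hk0T, hcard]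
    rw [Finset.sum_congr rfl h1, Finset.sum_powerset_apply_card
      (fun t : ℕ => (-1 : ZMod p) ^ (p - 2 - t) * (if hh (a j * (t : ZMod p) + a k) then (1 : ZMod p) else 0)), hcard]
  have e0 : moeb (fun u => if hh (blin A a u) then (1 : ZMod p) else 0) S =
      ∑ s ∈ range (p - 2 + 1), ((p - 2).choose s) •
        ((-1 : ZMod p) ^ (p - 2 - s) * (if hh (a j * (s : ZMod p)) then (1 : ZMod p) else 0)) := by
    unfold moeb
    have h1 : ∀ T ∈ S.powerset, (-1 : ZMod p) ^ (S.card - T.card) *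
        (fun u => if hh (blin A a u) then (1 : ZMod p) else 0) (vert T) =
          (fun t : ℕ => (-1 : ZMod p) ^ (p - 2 - t) *
            (if hh (a j * (t : ZMod p)) then (1 : ZMod p) else 0)) T.card := by
      intro T hT
      simp only
      rw [blin_vert_subset hdis ((mem_powerset.1 hT).trans hS), hcard]
    rw [Finset.sum_congr rfl h1, Finset.sum_powerset_apply_card
      (fun t : ℕ => (-1 : ZMod p) ^ (p - 2 - t) * (if hh (a j * (t : ZMod p)) then (1 : ZMod p) else 0)), hcard]
  rw [e1, e0, ← Finset.sum_sub_distrib, show p - 2 + 1 = p - 1 by omega, Finset.mul_sum]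
  refine Finset.sum_congr rfl fun s hs => ?_
  have hs' : s ≤ p - 2 := by have := mem_range.1 hs; omega
  rw [nsmul_eq_mul, nsmul_eq_mul, choose_predpred_prime_cast p s hs']
  have key : (-1 : ZMod p) ^ s * (-1) ^ (p - 2 - s) = (-1) ^ p := by
    rw [← pow_add, show s + (p - 2 - s) = p - 2 by omega]
    have h2 : (-1 : ZMod p) ^ p = (-1) ^ (p - 2) * (-1) ^ 2 := by
      rw [← pow_add, Nat.sub_add_cancel (show 2 ≤ p by omega)]
    rw [h2]
    ring
  linear_combination (((s : ZMod p) + 1) *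
    ((if hh (a j * (s : ZMod p) + a k) then (1 : ZMod p) else 0) -
      (if hh (a j * (s : ZMod p)) then (1 : ZMod p) else 0))) * key

end SubChar

end Summit.QuantumAdvantage.AdviceFreeQNC0
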